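import Literature.AlgebraicGeometry.Milne1999.HodgeGroupPowersDiagonal
import Literature.AlgebraicGeometry.Milne1999.SpecialLefschetzGroupInvariantsProducts
import Literature.AlgebraicGeometry.Deligne1982.HodgeGroupInvariantClasses
import Literature.AlgebraicGeometry.HodgeTheory.HodgeGroupProductCMFactor
import HarnessLib

/-!
# `Hg(B × C) ≤ Hg(B) × Hg(C)`, and `Hg(B × C) = Hg(B) × Hg(C)` iff the Hodge classes of every `B^{a+1} × C^{a+1}` are spanned by the exterior products (Moonen–Zarhin 1999, §3 (3.1) — Tannaka-free, on the real carriers)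

Family `hodge`, layer `Literature/AlgebraicGeometry/Milne1999`, namespace `Literature.AlgebraicGeometry.Milne1999` (D-0022).
THEOREMS ONLY (no definition, no named fact, no `sorry`; net debt 0). Sequel of `Milne1999/HodgeGroupPowersDiagonal`
(Moonen–Zarhin §1, `Hg(A^{r+1}) = Hg(A)` acting diagonally, Tannaka-free) and of `Milne1999/SpecialLefschetzGroupInvariantsProducts`
(Milne's Lemma 3.1 on the Künneth coordinates of `H*(B × C)`), written for the cell `pub-hodge-ring2` (HONEST FRAMING: research route
conditional on HC_CM; not a corollary; Q11.4-sentence-2 already refuted in dim ≥ 3; seat `ring2-b06`, the PRODUCTS chapter of its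
`GL(H¹)`-dictionary). Nothing in this file is a case of the Hodge conjecture or of that cell's binder; it is a theorem in print about
Hodge structures, certified on the tree's carriers.

## Source, verbatim (held text `paper:arxiv-math_9901113` = B. Moonen, Yu. G. Zarhin, *Hodge classes on abelian varieties of low
dimension*, Math. Ann. 315 (1999) 711–733, doi:10.1007/s002080050333; chunk p0006 L24–L58 and p0002 L137–L141, re-opened for this file)

* §3, (3.1): "Let `X_1` and `X_2` be complex abelian varieties. Write `X = X_1 × X_2`. Then `Hg(X)` is an algebraic subgroup of
  `Hg(X_1) × Hg(X_2)`. The two projections `pr_i : Hg(X) → Hg(X_i)` are surjective. […] We may have that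
  `Hg(X_1 × X_2) ≠ Hg(X_1) × Hg(X_2)`. (1) […] This holds if and only if for some `m` and `n` the Hodge ring `B(X_1^m × X_2^n)` is not
  generated by the elements coming from `B(X_1^m)` and `B(X_2^n)`." (`B^i(X) = H^{2i}(X, ℚ)^{Hg}` the Hodge classes, §1.)
* §1: "For `n ≥ 1` we can identify `Hg(Xⁿ)` with `Hg(X)`, acting diagonally on `V_{Xⁿ} = (V_X)ⁿ`. More generally, if
  `n_1, …, n_r ∈ ℤ_{≥1}` then we can identify `Hg(X_1^{n_1} × ⋯ × X_r^{n_r})` with `Hg(X_1 × ⋯ × X_r)`."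
* J. S. Milne, *Lefschetz classes on abelian varieties*, Duke Math. J. 96 (1999), §1 p. 643: "Let `A = A_1 × ⋯ × A_s`. Then
  `C(A) ⊂ C(A_1) × ⋯ × C(A_s)`"; Lemma 3.1 (pp. 652–653): "`(V ⊗_k W)^{G × H} = V^G ⊗_k W^H` […] Any element `x` of `V ⊗_k W` can be
  written uniquely `x = Σᵢ aᵢ ⊗ fᵢ` with `aᵢ ∈ V`. If `x` is fixed by all `(g, 1) ∈ G(k) × H(k)`, then `gaᵢ = aᵢ` for all `i`".
* P. Deligne, *Hodge cycles on abelian varieties*, LNM 900 (1982), I Prop. 3.4: the `G⁰`-fixed tensors are the `(0,0)`-classes (on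
  the carriers: `Deligne1982/HodgeGroupInvariantClasses`, `(H²ᵖ(X(ℂ); ℂ))^{Hg(X)(ℂ)} = (Hodge classes) ⊗ ℂ`).

## The objects (all pre-existing in the tree)

`Hg(Y)(ℂ) = HodgeTheory.hodgeGroup (dim Y) Y.X ≤ ∏ₖ GL(Hᵏ(Y(ℂ); ℂ))` — the Künneth families on the powers `Y.X^{×(a+1)}` fixing every
rational `(p,p)`-class (`HodgeTheory/MotivatedGaloisGroup`; Tannaka-free: no algebraic group, no Lie algebra); its degree-one image
`Hg(Y)(ℂ)|_{H¹} = VanGeemen1994.hodgeGroupOne`; for an abelian variety every `g ∈ Hg(Y)(ℂ)` is `⋀•(g₁)`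
(`hodgeGroup_eq_exteriorPullbackEquiv`, van Geemen 6.5) with `g₁ ∈ C(Y) ⊗ ℂ` (`hodgeGroupOne_le_centralizerGroup`). On a product,
`s ⊕ t = prodBlockDiagEquiv s t` on `H¹(B × C) = pr_B^* H¹(B) ⊕ pr_C^* H¹(C)` and `⋀•(s ⊕ t) = exteriorPullback[Equiv] … (s ⊕ t)`;
`u^{⊕(a+1)} = diagPow`, `⋀•(u^{⊕(a+1)}) = diagPowExterior` on `Y^{a+1} = Y.powSucc a`. `HodgeClassesProductSpan B C`
(`HodgeTheory/HodgeGroupProductCMFactor`): every rational `(p,p)`-class of `B × C` lies in the `ℂ`-span of the exterior products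
`pr_B^* a ∪ pr_C^* b` of rational Hodge classes (`hodgeProductClasses B C p`). "THE HODGE GROUP OF `B × C` SPLITS" is said INLINE,
Tannaka-free: `∀ u ∈ Hg(B)(ℂ)|_{H¹}, ∀ v ∈ Hg(C)(ℂ)|_{H¹}, ⋀•(u ⊕ v) ∈ Hg(B × C)(ℂ)` (displayed hypothesis `hsplit`; no definition).

## What is proved

* §1 `exteriorPullbackEquiv_mem_hodgeGroup_of_retraction` — **TRANSFER ALONG AN INTERTWINING RETRACTION**: for homomorphisms
  `ι : Q → P`, `π : P → Q` with `ι ≫ π = 𝟙` and `u_P ∘ π^* = π^* ∘ u_Q` on `H¹`, `⋀•u_P ∈ Hg(P)(ℂ) ⟹ ⋀•u_Q ∈ Hg(Q)(ℂ)` (the one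
  mechanism behind Moonen–Zarhin §1 and the first sentence of (3.1); with `exists_retraction_powSucc_of_intertwine`, the induced
  retractions `Q^{a+1} ⇄ P^{a+1}` intertwining the diagonals).
* §2 **`Hg(B × C) ≤ Hg(B) × Hg(C)`** (`exists_eq_prodBlockDiagEquiv_of_mem_hodgeGroup_prod`, `…_of_mem_hodgeGroupOne_prod`): every
  `g' ∈ Hg(B × C)(ℂ)` is `⋀•(u ⊕ v)` with `u ∈ Hg(B)(ℂ)|_{H¹}`, `v ∈ Hg(C)(ℂ)|_{H¹}` — `g'₁ ∈ C(B × C) ⊂ C(B) × C(C)` is block diagonal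
  (Milne §1 p. 643, the tree's `prodBlockDiag_eq_of_mem_centralizerGroup`), and each block transfers to its factor along
  `B ⇄ B × C`, `C ⇄ B × C`. NO hypothesis on `(B, C)`.
* §3 **LEMMA 3.1 FOR THE HODGE GROUPS** (`mem_span_hodgeProductClasses_of_forall_exteriorPullback_prodBlockDiagEquiv_eq`,
  `forall_…_iff_mem_span_hodgeProductClasses`): a class of `H²ᵖ((B × C)(ℂ); ℂ)` is fixed by all `⋀^{2p}(s ⊕ t)`,
  `s ∈ Hg(B)(ℂ)|_{H¹}`, `t ∈ Hg(C)(ℂ)|_{H¹}`, IFF it lies in `span_ℂ (hodgeProductClasses B C p)` — Milne's coordinate proof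
  (`kunnethSum_bijective`, `exists_eq_sum_repr_smul_of_forall_eq_sum_repr_smul`) with Deligne I 3.4 on each factor
  (`cupProduct_map_fst_map_snd_mem_span_hodgeProductClasses`; odd-degree invariants vanish). NO hypothesis on `(B, C)`.
* §4 **(3.1) `⟹`**: if `Hg(B × C)` splits then `HodgeClassesProductSpan B C` (`hodgeClassesProductSpan_of_forall_prodBlockDiagEquiv_mem_hodgeGroup`),
  splitting passes to `(B^{a+1}, C^{a+1})` (`forall_prodBlockDiagEquiv_mem_hodgeGroup_powSucc`, through the shuffle
  `(B × C)^{a+1} ≅ B^{a+1} × C^{a+1}` of §0, `exists_shuffle_powSucc_prod`, which intertwines `(u ⊕ v)^{⊕(a+1)}` with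
  `u^{⊕(a+1)} ⊕ v^{⊕(a+1)}`), hence `HodgeClassesProductSpan (B^{a+1}) (C^{a+1})` for all `a`.
* §5 **(3.1) `⟸`** (`prodBlockDiagEquiv_mem_hodgeGroup_of_forall_hodgeClassesProductSpan_powSucc`): if the Hodge classes of every
  `B^{a+1} × C^{a+1}` are spanned by the exterior products, then `Hg(B × C)` splits.
* §6 the criterion `forall_prodBlockDiagEquiv_mem_hodgeGroup_iff_forall_hodgeClassesProductSpan_powSucc`; under splitting
  `Hg(B × C)(ℂ) = {⋀•(u ⊕ v)}` exactly (`mem_hodgeGroup_prod_iff_of_…`, `H¹` form `mem_hodgeGroupOne_prod_iff_of_…`) and the Hodge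
  conjecture for `B^{a+1}`, `C^{a+1}` gives it for `B^{a+1} × C^{a+1}` (`hodgeConjectureFor_powSucc_prod_powSucc_of_…`, through the
  tree's `hodgeConjectureFor_prod_of_productSpan`).

UPSHOT for the tree's product programme (`HodgeTheory/HodgeGroupProductCMFactor`, `…SemisimpleCMFactor`, `NoTypeIVTimesCMProductSpan`):
the step "(3.1): when the Hodge group of `X_1 × X_2` splits, `B(X_1 × X_2)` is generated by the factors", quoted there and used
inside the named facts `Gordon1999_hodgeClassesProductSpan_of_semisimple` / (the discharged) `Lombardo2016_hodgeClassesProductSpan`,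
is now a theorem about the Tannaka-free `hodgeGroup`: what such a fact asserts beyond this file is exactly the GROUP statement
"`Hg(A)` semisimple, `C` CM ⟹ `Hg(A × C)` splits" (Goursat; not provable without the algebraic-group structure).

## What is NOT here (honest column)

The surjectivity of `pr_i : Hg(X) → Hg(X_i)` and the Lie-algebra picture `𝔤₁ ⊕ 𝔤₂ ⊕ Γ_φ` of (3.1) (algebraic groups); unequal
exponents `X_1^m × X_2^n`, `m ≠ n` (reduce to `max(m,n)` by Moonen–Zarhin §1 — a retraction `(B × C)^{N+1} → B^{m+1} × C^{n+1}`
intertwining the diagonals would do, not recorded); any criterion FOR splitting (Hazama / Moonen–Zarhin (3.2), Lombardo 3.4, Gordon: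
these are the named facts of the product programme, untouched); products of three or more factors (iterate); the analogous
statements for Milne's `S`, André's `G¹_mot` and the other stabilisers of the `pub-hodge-ring2` dictionary (same mechanism; Milne's
`S(B × C) = S(B) × S(C)` for `Hom`-orthogonal pairs is `SpecialLefschetzGroupInvariantsProducts` on `H¹`). PRESEARCH (2026-08-22):
corpus `paper:arxiv-math_9901113` p0006 / p0002 re-opened (quotes above); the tree's `HodgeTheory/HodgeClassesProductSpan{Criterion,
TypedCriterion,Transport}` prove Hodge-group-FREE criteria for `HodgeClassesProductSpan` and its bookkeeping, and
`Geometry/Kaehler/ComplexTorusHodgeGroup*` treat `Hg` of products of complex tori as matrix groups — neither states (3.1) for the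
Tannaka-free `hodgeGroup`; no novelty beyond certification on the carriers is claimed.

## References

* [MoonenZarhin1999LowDim] B. Moonen, Yu. G. Zarhin, Hodge classes on abelian varieties of low dimension, Math. Ann. 315 (1999)
  711–733: §1 (powers), §3 (3.1).
* [Milne1999LefschetzClasses] J. S. Milne, Lefschetz classes on abelian varieties, Duke Math. J. 96 (1999) 639–675: §1 p. 643,
  Lemma 3.1 (pp. 652–653), Def. 4.3, Thm. 4.4.
* [Deligne1982HodgeCycles] P. Deligne (notes by J. S. Milne), Hodge cycles on abelian varieties, LNM 900 (1982): I §3, Prop. 3.4,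
  and the special Mumford–Tate group before Thm. 3.8.
* [vanGeemen1994HodgeAV] B. van Geemen, An introduction to the Hodge conjecture for abelian varieties, LNM 1594 (1994): 6.4–6.5.
* [LangeBirkenhake1992] H. Lange, Ch. Birkenhake, Complex Abelian Varieties (1992): Lemma 1.1.17, Thm. 4.2.1.
* [HatcherAT2002] A. Hatcher, Algebraic Topology (2002): §3.2 Thm. 3.16 (Künneth).
* [VoisinHodgeII2003] C. Voisin, Hodge Theory and Complex Algebraic Geometry II: proof of Prop. 9.20 (exterior products of
  algebraic classes).
-/

noncomputable section

open CategoryTheory MonoidalCategory CartesianMonoidalCategory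
open Literature.AlgebraicTopology.SingularHomology
open Literature.AlgebraicGeometry.HodgeTheory
open Literature.AlgebraicGeometry.Motives
open Literature.AlgebraicGeometry.VanGeemen1994 (hodgeGroupOne mem_hodgeGroupOne_iff)

namespace Literature.AlgebraicGeometry.Milne1999

/-! ### §0 Plumbing: the shuffle `(B × C)^{a+1} ≅ B^{a+1} × C^{a+1}` intertwines the diagonal actions -/

section Plumbing

/-- `h ≫ (f, g) = (h ≫ f, h ≫ g)`. [folklore] -/
private theorem comp_prodLift {T T' X Y : AbelianVariety ℂ} (h : T' ⟶ T) (f : T ⟶ X) (g : T ⟶ Y) :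
    h ≫ AbelianVariety.prodLift f g = AbelianVariety.prodLift (h ≫ f) (h ≫ g) :=
  AbelianVariety.prod_hom_ext (by rw [Category.assoc, AbelianVariety.prodLift_fst, AbelianVariety.prodLift_fst])
    (by rw [Category.assoc, AbelianVariety.prodLift_snd, AbelianVariety.prodLift_snd])

/-- `(pr₁ ≫ f, pr₂ ≫ f') = 𝟙` when `f = 𝟙`, `f' = 𝟙`: `(pr₁, pr₂) = 𝟙`. [folklore] -/
private theorem prodLift_fst_snd (X Y : AbelianVariety ℂ) :
    AbelianVariety.prodLift (AbelianVariety.fst X Y) (AbelianVariety.snd X Y) = 𝟙 (X.prod Y) :=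
  AbelianVariety.prod_hom_ext (by rw [AbelianVariety.prodLift_fst, Category.id_comp])
    (by rw [AbelianVariety.prodLift_snd, Category.id_comp])

variable {P X C' B C : AbelianVariety ℂ} (σ : P ⟶ X.prod C') (τ : X.prod C' ⟶ P)

/-- Shuffle step, first identity: with `σ' = ((pr₁σpr₁, pr₂pr₁), (pr₁σpr₂, pr₂pr₂)) : P × (B × C) → (X × B) × (C' × C)` and
`τ' = ((pr₁pr₁, pr₂pr₁)τ, (pr₁pr₂, pr₂pr₂))` the other way, `σ ≫ τ = 𝟙 ⟹ σ' ≫ τ' = 𝟙`. [folklore] -/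
private theorem shuffle_comp (hστ : σ ≫ τ = 𝟙 P) :
    AbelianVariety.prodLift
        (AbelianVariety.prodLift (AbelianVariety.fst P (B.prod C) ≫ σ ≫ AbelianVariety.fst X C')
          (AbelianVariety.snd P (B.prod C) ≫ AbelianVariety.fst B C))
        (AbelianVariety.prodLift (AbelianVariety.fst P (B.prod C) ≫ σ ≫ AbelianVariety.snd X C')
          (AbelianVariety.snd P (B.prod C) ≫ AbelianVariety.snd B C)) ≫
      AbelianVariety.prodLift
        (AbelianVariety.prodLift (AbelianVariety.fst (X.prod B) (C'.prod C) ≫ AbelianVariety.fst X B)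
          (AbelianVariety.snd (X.prod B) (C'.prod C) ≫ AbelianVariety.fst C' C) ≫ τ)
        (AbelianVariety.prodLift (AbelianVariety.fst (X.prod B) (C'.prod C) ≫ AbelianVariety.snd X B)
          (AbelianVariety.snd (X.prod B) (C'.prod C) ≫ AbelianVariety.snd C' C)) = 𝟙 (P.prod (B.prod C)) := by
  rw [comp_prodLift, ← Category.assoc, comp_prodLift, comp_prodLift]
  simp only [AbelianVariety.prodLift_fst_assoc, AbelianVariety.prodLift_snd_assoc, AbelianVariety.prodLift_fst,
    AbelianVariety.prodLift_snd]
  rw [← comp_prodLift, ← comp_prodLift, prodLift_fst_snd, Category.comp_id, ← comp_prodLift, prodLift_fst_snd,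
    Category.comp_id, Category.assoc, hστ, Category.comp_id, prodLift_fst_snd]

/-- Shuffle step, second identity: `τ ≫ σ = 𝟙 ⟹ τ' ≫ σ' = 𝟙`. [folklore] -/
private theorem shuffle_comp' (hτσ : τ ≫ σ = 𝟙 (X.prod C')) :
    AbelianVariety.prodLift
        (AbelianVariety.prodLift (AbelianVariety.fst (X.prod B) (C'.prod C) ≫ AbelianVariety.fst X B)
          (AbelianVariety.snd (X.prod B) (C'.prod C) ≫ AbelianVariety.fst C' C) ≫ τ)
        (AbelianVariety.prodLift (AbelianVariety.fst (X.prod B) (C'.prod C) ≫ AbelianVariety.snd X B)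
          (AbelianVariety.snd (X.prod B) (C'.prod C) ≫ AbelianVariety.snd C' C)) ≫
      AbelianVariety.prodLift
        (AbelianVariety.prodLift (AbelianVariety.fst P (B.prod C) ≫ σ ≫ AbelianVariety.fst X C')
          (AbelianVariety.snd P (B.prod C) ≫ AbelianVariety.fst B C))
        (AbelianVariety.prodLift (AbelianVariety.fst P (B.prod C) ≫ σ ≫ AbelianVariety.snd X C')
          (AbelianVariety.snd P (B.prod C) ≫ AbelianVariety.snd B C)) = 𝟙 ((X.prod B).prod (C'.prod C)) := by
  rw [comp_prodLift, comp_prodLift, comp_prodLift]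
  simp only [AbelianVariety.prodLift_fst_assoc, AbelianVariety.prodLift_snd_assoc, Category.assoc, reassoc_of% hτσ,
    AbelianVariety.prodLift_fst, AbelianVariety.prodLift_snd]
  rw [← comp_prodLift, ← comp_prodLift, prodLift_fst_snd, Category.comp_id, prodLift_fst_snd, Category.comp_id, prodLift_fst_snd]

/-- Shuffle step, intertwining on `H¹`: if `U_P ∘ σ^* = σ^* ∘ (U_X ⊕ U_{C'})`, then
`(U_P ⊕ (u ⊕ v)) ∘ σ'^* = σ'^* ∘ ((U_X ⊕ u) ⊕ (U_{C'} ⊕ v))` (blockwise, `apply_map_eq_map_prodBlockDiagEquiv`).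
[cite: Milne1999LefschetzClasses, §1 p. 643] [cite: HatcherAT2002, §3.2 Thm. 3.16] -/
private theorem shuffle_intertwine (UP : complexBetti P.X 1 ≃ₗ[ℂ] complexBetti P.X 1) (UX : complexBetti X.X 1 ≃ₗ[ℂ] complexBetti X.X 1)
    (UC' : complexBetti C'.X 1 ≃ₗ[ℂ] complexBetti C'.X 1) (u : complexBetti B.X 1 ≃ₗ[ℂ] complexBetti B.X 1)
    (v : complexBetti C.X 1 ≃ₗ[ℂ] complexBetti C.X 1)
    (hσ : ∀ y : complexBetti (X.prod C').X 1,
      UP (complexBetti.map σ.hom.hom.hom 1 y) = complexBetti.map σ.hom.hom.hom 1 (prodBlockDiagEquiv UX UC' y))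
    (y : complexBetti ((X.prod B).prod (C'.prod C)).X 1) :
    prodBlockDiagEquiv UP (prodBlockDiagEquiv u v)
        (complexBetti.map (AbelianVariety.prodLift
          (AbelianVariety.prodLift (AbelianVariety.fst P (B.prod C) ≫ σ ≫ AbelianVariety.fst X C')
            (AbelianVariety.snd P (B.prod C) ≫ AbelianVariety.fst B C))
          (AbelianVariety.prodLift (AbelianVariety.fst P (B.prod C) ≫ σ ≫ AbelianVariety.snd X C')
            (AbelianVariety.snd P (B.prod C) ≫ AbelianVariety.snd B C))).hom.hom.hom 1 y) =
      complexBetti.map (AbelianVariety.prodLift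
          (AbelianVariety.prodLift (AbelianVariety.fst P (B.prod C) ≫ σ ≫ AbelianVariety.fst X C')
            (AbelianVariety.snd P (B.prod C) ≫ AbelianVariety.fst B C))
          (AbelianVariety.prodLift (AbelianVariety.fst P (B.prod C) ≫ σ ≫ AbelianVariety.snd X C')
            (AbelianVariety.snd P (B.prod C) ≫ AbelianVariety.snd B C))).hom.hom.hom 1
        (prodBlockDiagEquiv (prodBlockDiagEquiv UX u) (prodBlockDiagEquiv UC' v) y) := by
  refine apply_map_eq_map_prodBlockDiagEquiv _ _ _ _ (fun q ↦ ?_) (fun z ↦ ?_) y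
  · rw [AbelianVariety.prodLift_fst]
    refine apply_map_eq_map_prodBlockDiagEquiv _ _ _ _ (fun q' ↦ ?_) (fun b ↦ ?_) q
    · rw [AbelianVariety.prodLift_fst, complexBetti_map_comp_apply, complexBetti_map_comp_apply, prodBlockDiagEquiv_apply_map_fst,
        hσ, prodBlockDiagEquiv_apply_map_fst, complexBetti_map_comp_apply, complexBetti_map_comp_apply]
    · rw [AbelianVariety.prodLift_snd, complexBetti_map_comp_apply, prodBlockDiagEquiv_apply_map_snd,
        prodBlockDiagEquiv_apply_map_fst, complexBetti_map_comp_apply]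
  · rw [AbelianVariety.prodLift_snd]
    refine apply_map_eq_map_prodBlockDiagEquiv _ _ _ _ (fun q' ↦ ?_) (fun c ↦ ?_) z
    · rw [AbelianVariety.prodLift_fst, complexBetti_map_comp_apply, complexBetti_map_comp_apply, prodBlockDiagEquiv_apply_map_fst,
        hσ, prodBlockDiagEquiv_apply_map_snd, complexBetti_map_comp_apply, complexBetti_map_comp_apply]
    · rw [AbelianVariety.prodLift_snd, complexBetti_map_comp_apply, prodBlockDiagEquiv_apply_map_snd,
        prodBlockDiagEquiv_apply_map_snd, complexBetti_map_comp_apply]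

variable (B C)

/-- **The shuffle `(B × C)^{a+1} ≅ B^{a+1} × C^{a+1}`** (an isomorphism of abelian varieties built from projections and
pairings only) **intertwines the diagonal actions on `H¹`**: `(u ⊕ v)^{⊕(a+1)} ∘ σ^* = σ^* ∘ (u^{⊕(a+1)} ⊕ v^{⊕(a+1)})` for
ALL `u ∈ GL(H¹(B(ℂ); ℂ))`, `v ∈ GL(H¹(C(ℂ); ℂ))` (Moonen–Zarhin §1: "we can identify `Hg(X_1^{n_1} × ⋯ × X_r^{n_r})` with
`Hg(X_1 × ⋯ × X_r)`", case `n_1 = n_2`). Recursion on `a` along `(B × C)^{a+2} = (B × C)^{a+1} × (B × C)`,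
`B^{a+2} × C^{a+2} = (B^{a+1} × B) × (C^{a+1} × C)`. [cite: MoonenZarhin1999LowDim, §1] [cite: LangeBirkenhake1992, Thm. 4.2.1] -/
theorem exists_shuffle_powSucc_prod : ∀ a : ℕ,
    ∃ (σ : (B.prod C).powSucc a ⟶ (B.powSucc a).prod (C.powSucc a)) (τ : (B.powSucc a).prod (C.powSucc a) ⟶ (B.prod C).powSucc a),
      σ ≫ τ = 𝟙 _ ∧ τ ≫ σ = 𝟙 _ ∧
        ∀ (u : complexBetti B.X 1 ≃ₗ[ℂ] complexBetti B.X 1) (v : complexBetti C.X 1 ≃ₗ[ℂ] complexBetti C.X 1)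
          (y : complexBetti ((B.powSucc a).prod (C.powSucc a)).X 1),
          diagPow (B.prod C) (prodBlockDiagEquiv u v) a (complexBetti.map σ.hom.hom.hom 1 y) =
            complexBetti.map σ.hom.hom.hom 1 (prodBlockDiagEquiv (diagPow B u a) (diagPow C v a) y)
  | 0 => ⟨𝟙 _, 𝟙 _, Category.comp_id _, Category.comp_id _, fun u v y ↦ by
      change prodBlockDiagEquiv u v (complexBetti.map (𝟙 (B.prod C).X) 1 y) =
        complexBetti.map (𝟙 (B.prod C).X) 1 (prodBlockDiagEquiv u v y)
      rw [complexBetti.map_id]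
      rfl⟩
  | a + 1 => by
    obtain ⟨σ, τ, hστ, hτσ, hint⟩ := exists_shuffle_powSucc_prod a
    exact ⟨_, _, shuffle_comp σ τ hστ, shuffle_comp' σ τ hτσ, fun u v y ↦ by
      rw [diagPow_succ, diagPow_succ, diagPow_succ]
      exact shuffle_intertwine σ _ _ _ u v (hint u v) y⟩

end Plumbing

/-! ### §1 `Hg` acts through `H¹`: two read-outs, and the transfer of membership along an intertwining retraction -/

section Transfer

variable {A : AbelianVariety ℂ}

/-- For `s ∈ Hg(A)(ℂ)|_{H¹}`, `⋀•s` fixes every rational `(p,p)`-class of `A` (`s = g₁`, `g = ⋀•(g₁)` fixes the Hodge classes).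
[cite: Deligne1982HodgeCycles, I §3 (before Thm. 3.8)] [cite: vanGeemen1994HodgeAV, 6.4–6.5] -/
theorem exteriorPullback_apply_eq_self_of_mem_hodgeGroupOne {s : complexBetti A.X 1 ≃ₗ[ℂ] complexBetti A.X 1}
    (hs : s ∈ hodgeGroupOne A.dim A.X) {p : ℕ} {c : complexBetti A.X (2 * p)} (hc : IsRationalClass c)
    (hc' : IsOfHodgeType A.dim A.X (2 * p) p p c) :
    exteriorPullback (AbelianVariety.hasExteriorCohomologyH1_complexPoints A) s.toLinearMap (2 * p) c = c := by
  obtain ⟨g, hg, rfl⟩ := mem_hodgeGroupOne_iff.1 hs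
  have e := apply_eq_self_of_mem_hodgeGroup hg hc hc'
  rw [hodgeGroup_eq_exteriorPullbackEquiv hg] at e
  exact e

/-- A class fixed by all `⋀ᵏs`, `s ∈ Hg(A)(ℂ)|_{H¹}`, is fixed by `Hg(A)(ℂ)` (every `g ∈ Hg(A)(ℂ)` is `⋀•(g₁)`).
[cite: vanGeemen1994HodgeAV, 6.4–6.5] [cite: Deligne1982HodgeCycles, I §3] -/
theorem forall_hodgeGroup_apply_eq_of_forall_exteriorPullback_eq {k : ℕ} {y : complexBetti A.X k}
    (h : ∀ s ∈ hodgeGroupOne A.dim A.X,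
      exteriorPullback (AbelianVariety.hasExteriorCohomologyH1_complexPoints A) s.toLinearMap k y = y) :
    ∀ g ∈ hodgeGroup A.dim A.X, g k y = y := by
  intro g hg
  have e := h (g 1) (mem_hodgeGroupOne_iff.2 ⟨g, hg, rfl⟩)
  rw [← exteriorPullbackEquiv_apply] at e
  have hg' := congrFun (hodgeGroup_eq_exteriorPullbackEquiv hg) k
  rw [hg']
  exact e

/-- A product of retractions is a retraction (generic objects, so that no power has to be unfolded). [folklore] -/
private theorem retraction_step {X X' Y Y' : AbelianVariety ℂ} {ι : X ⟶ X'} {π : X' ⟶ X} (h : ι ≫ π = 𝟙 X) {ι₀ : Y ⟶ Y'}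
    {π₀ : Y' ⟶ Y} (h₀ : ι₀ ≫ π₀ = 𝟙 Y) :
    AbelianVariety.prodLift (AbelianVariety.fst X Y ≫ ι) (AbelianVariety.snd X Y ≫ ι₀) ≫
        AbelianVariety.prodLift (AbelianVariety.fst X' Y' ≫ π) (AbelianVariety.snd X' Y' ≫ π₀) = 𝟙 (X.prod Y) := by
  refine AbelianVariety.prod_hom_ext ?_ ?_
  · rw [Category.assoc, AbelianVariety.prodLift_fst, ← Category.assoc, AbelianVariety.prodLift_fst, Category.assoc, h,
      Category.id_comp, Category.comp_id]
  · rw [Category.assoc, AbelianVariety.prodLift_snd, ← Category.assoc, AbelianVariety.prodLift_snd, Category.assoc, h₀,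
      Category.id_comp, Category.comp_id]

/-- A product `π × π₀` of homomorphisms intertwining `H¹`-automorphisms blockwise intertwines the block sums (generic objects).
[cite: Milne1999LefschetzClasses, §1 p. 643] [cite: HatcherAT2002, §3.2 Thm. 3.16] -/
private theorem intertwine_step {X X' Y Y' : AbelianVariety ℂ} (π : X' ⟶ X) (π₀ : Y' ⟶ Y)
    (UX' : complexBetti X'.X 1 ≃ₗ[ℂ] complexBetti X'.X 1) (UX : complexBetti X.X 1 ≃ₗ[ℂ] complexBetti X.X 1)
    (UY' : complexBetti Y'.X 1 ≃ₗ[ℂ] complexBetti Y'.X 1) (UY : complexBetti Y.X 1 ≃ₗ[ℂ] complexBetti Y.X 1)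
    (hX : ∀ q : complexBetti X.X 1, UX' (complexBetti.map π.hom.hom.hom 1 q) = complexBetti.map π.hom.hom.hom 1 (UX q))
    (hY : ∀ z : complexBetti Y.X 1, UY' (complexBetti.map π₀.hom.hom.hom 1 z) = complexBetti.map π₀.hom.hom.hom 1 (UY z))
    (y : complexBetti (X.prod Y).X 1) :
    prodBlockDiagEquiv UX' UY' (complexBetti.map
        (AbelianVariety.prodLift (AbelianVariety.fst X' Y' ≫ π) (AbelianVariety.snd X' Y' ≫ π₀)).hom.hom.hom 1 y) =
      complexBetti.map (AbelianVariety.prodLift (AbelianVariety.fst X' Y' ≫ π) (AbelianVariety.snd X' Y' ≫ π₀)).hom.hom.hom 1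
        (prodBlockDiagEquiv UX UY y) :=
  apply_map_eq_map_prodBlockDiagEquiv _ _ _ _
    (fun q ↦ by rw [AbelianVariety.prodLift_fst, complexBetti_map_comp_apply, complexBetti_map_comp_apply,
      prodBlockDiagEquiv_apply_map_fst, hX])
    (fun z ↦ by rw [AbelianVariety.prodLift_snd, complexBetti_map_comp_apply, complexBetti_map_comp_apply,
      prodBlockDiagEquiv_apply_map_snd, hY]) y

/-- **Powers of an intertwining retraction.** A section–retraction pair `ι : Q → P`, `π : P → Q` (`ι ≫ π = 𝟙`) with
`u_P ∘ π^* = π^* ∘ u_Q` on `H¹` induces, for every `a`, a section–retraction pair `Q^{a+1} ⇄ P^{a+1}` (blockwise) whose retraction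
intertwines the diagonals: `u_P^{⊕(a+1)} ∘ π_a^* = π_a^* ∘ u_Q^{⊕(a+1)}`. [cite: Milne1999LefschetzClasses, §1 p. 643] [cite: LangeBirkenhake1992, Thm. 4.2.1] -/
theorem exists_retraction_powSucc_of_intertwine {P Q : AbelianVariety ℂ} (ι : Q ⟶ P) (π : P ⟶ Q) (hιπ : ι ≫ π = 𝟙 Q)
    (uP : complexBetti P.X 1 ≃ₗ[ℂ] complexBetti P.X 1) (uQ : complexBetti Q.X 1 ≃ₗ[ℂ] complexBetti Q.X 1)
    (h : ∀ y : complexBetti Q.X 1, uP (complexBetti.map π.hom.hom.hom 1 y) = complexBetti.map π.hom.hom.hom 1 (uQ y)) :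
    ∀ a : ℕ, ∃ (ι' : Q.powSucc a ⟶ P.powSucc a) (π' : P.powSucc a ⟶ Q.powSucc a), ι' ≫ π' = 𝟙 _ ∧
      ∀ y : complexBetti (Q.powSucc a).X 1,
        diagPow P uP a (complexBetti.map π'.hom.hom.hom 1 y) = complexBetti.map π'.hom.hom.hom 1 (diagPow Q uQ a y)
  | 0 => ⟨ι, π, hιπ, h⟩
  | a + 1 => by
    obtain ⟨ι', π', hιπ', hint⟩ := exists_retraction_powSucc_of_intertwine ι π hιπ uP uQ h a
    exact ⟨_, _, retraction_step hιπ' hιπ, fun y ↦ by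
      rw [diagPow_succ, diagPow_succ]
      exact intertwine_step π' π _ _ _ _ hint h y⟩

/-- **Transfer of Hodge-group membership along an intertwining retraction.** Let `ι : Q → P`, `π : P → Q` be homomorphisms of
complex abelian varieties with `ι ≫ π = 𝟙`, and `u_P ∈ GL(H¹(P))`, `u_Q ∈ GL(H¹(Q))` with `u_P ∘ π^* = π^* ∘ u_Q`. If `⋀•u_P ∈ Hg(P)(ℂ)`
then `⋀•u_Q ∈ Hg(Q)(ℂ)`: a Hodge class `c` of `Q^{a+1}` pulls back along the retraction `π_a` to a Hodge class of `P^{a+1}`, fixed by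
`⋀•(u_P^{⊕(a+1)})` (the Künneth family of `⋀•u_P`); `π_a^*` intertwines and is injective. This is the one mechanism behind
`Hg(A^{r+1}) = Hg(A)` (`Milne1999/HodgeGroupPowersDiagonal`) and `Hg(B × C) ≤ Hg(B) × Hg(C)` below.
[cite: MoonenZarhin1999LowDim, §1 and §3 (3.1)] [cite: Milne1999LefschetzClasses, §1 p. 643] -/
theorem exteriorPullbackEquiv_mem_hodgeGroup_of_retraction {P Q : AbelianVariety ℂ} (ι : Q ⟶ P) (π : P ⟶ Q) (hιπ : ι ≫ π = 𝟙 Q)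
    {uP : complexBetti P.X 1 ≃ₗ[ℂ] complexBetti P.X 1} {uQ : complexBetti Q.X 1 ≃ₗ[ℂ] complexBetti Q.X 1}
    (h : ∀ y : complexBetti Q.X 1, uP (complexBetti.map π.hom.hom.hom 1 y) = complexBetti.map π.hom.hom.hom 1 (uQ y))
    (hP : (fun k ↦ exteriorPullbackEquiv (AbelianVariety.hasExteriorCohomologyH1_complexPoints P) uP k) ∈ hodgeGroup P.dim P.X) :
    (fun k ↦ exteriorPullbackEquiv (AbelianVariety.hasExteriorCohomologyH1_complexPoints Q) uQ k) ∈ hodgeGroup Q.dim Q.X := by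
  refine exteriorPullbackEquiv_mem_hodgeGroup_of_forall fun a p c hc hc' ↦ ?_
  obtain ⟨ι', π', hιπ', hint⟩ := exists_retraction_powSucc_of_intertwine ι π hιπ uP uQ h a
  have hQ : IsSmoothProjective (Q.powSucc a).dim (Q.powSucc a).X := AbelianVariety.isSmoothProjective_holds
  have hPP : IsSmoothProjective (P.powSucc a).dim (P.powSucc a).X := AbelianVariety.isSmoothProjective_holds
  have hfix := diagPowExterior_apply_eq_self_of_mem_hodgeGroup hP a p (c := complexBetti.map π'.hom.hom.hom (2 * p) c)
    (hc.pullback _) (hc'.map_of_isSmoothProjective hPP hQ π'.hom.hom.hom)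
  rw [exteriorPullbackEquiv_one_eq, diagPowExterior, exteriorPullbackEquiv_apply,
    exteriorPullback_map_of_intertwine π' (diagPow P uP a).toLinearMap (diagPow Q uQ a).toLinearMap (fun y ↦ hint y)] at hfix
  have e := congrArg (complexBetti.map ι'.hom.hom.hom (2 * p)) hfix
  rwa [map_map_of_comp_eq_id hιπ', map_map_of_comp_eq_id hιπ', ← exteriorPullbackEquiv_apply] at e

end Transfer

/-! ### §2 `Hg(B × C) ≤ Hg(B) × Hg(C)`: every element of the Hodge group of a product is block diagonal with Hodge blocks -/

section Product

variable (B C : AbelianVariety ℂ)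

/-- **Moonen–Zarhin (3.1), first sentence, Tannaka-free: "`Hg(X)` is an algebraic subgroup of `Hg(X_1) × Hg(X_2)`" (`X = X_1 × X_2`).**
Every `g' ∈ Hg(B × C)(ℂ)` is `⋀•(u ⊕ v)` with `⋀•u ∈ Hg(B)(ℂ)`, `⋀•v ∈ Hg(C)(ℂ)` (`u ∈ Hg(B)(ℂ)|_{H¹}`, `v ∈ Hg(C)(ℂ)|_{H¹}`): `g'` acts
through `H¹(B × C)` (`hodgeGroup_eq_exteriorPullbackEquiv`) by an element of `C(B × C) ⊗ ℂ ⊂ C(B) × C(C)` (Milne §1 p. 643: block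
diagonal, `prodBlockDiag_eq_of_mem_centralizerGroup`), and each block is transferred to the factor along the retractions
`B ⇄ B × C`, `C ⇄ B × C` (`exteriorPullbackEquiv_mem_hodgeGroup_of_retraction`). [cite: MoonenZarhin1999LowDim, §3 (3.1)]
[cite: Milne1999LefschetzClasses, §1 p. 643] -/
theorem exists_eq_prodBlockDiagEquiv_of_mem_hodgeGroup_prod
    {g' : ∀ k : ℕ, complexBetti (B.prod C).X k ≃ₗ[ℂ] complexBetti (B.prod C).X k} (hg' : g' ∈ hodgeGroup (B.prod C).dim (B.prod C).X) :
    ∃ u ∈ hodgeGroupOne B.dim B.X, ∃ v ∈ hodgeGroupOne C.dim C.X,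
      g' = fun k ↦ exteriorPullbackEquiv (AbelianVariety.hasExteriorCohomologyH1_complexPoints (B.prod C)) (prodBlockDiagEquiv u v) k := by
  have h1 : g' 1 ∈ centralizerGroup (B.prod C) := hodgeGroupOne_le_centralizerGroup (mem_hodgeGroupOne_iff.2 ⟨g', hg', rfl⟩)
  set u := centralizerGroup.restrictFstHom B C ⟨g' 1, h1⟩ with hu
  set v := centralizerGroup.restrictSndHom B C ⟨g' 1, h1⟩ with hv
  have hkey : prodBlockDiagEquiv u v = g' 1 := by
    refine LinearEquiv.toLinearMap_injective ?_
    rw [coe_prodBlockDiagEquiv, hu, hv, centralizerGroup.coe_restrictFstHom, centralizerGroup.coe_restrictSndHom]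
    exact prodBlockDiag_eq_of_mem_centralizerGroup h1
  have hg'eq : g' = fun k ↦ exteriorPullbackEquiv (AbelianVariety.hasExteriorCohomologyH1_complexPoints (B.prod C))
      (prodBlockDiagEquiv u v) k := by
    rw [hkey]; exact hodgeGroup_eq_exteriorPullbackEquiv hg'
  have hP : (fun k ↦ exteriorPullbackEquiv (AbelianVariety.hasExteriorCohomologyH1_complexPoints (B.prod C))
      (prodBlockDiagEquiv u v) k) ∈ hodgeGroup (B.prod C).dim (B.prod C).X := hg'eq ▸ hg'
  refine ⟨u, ?_, v, ?_, hg'eq⟩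
  · refine mem_hodgeGroupOne_iff.2 ⟨_, exteriorPullbackEquiv_mem_hodgeGroup_of_retraction
      (AbelianVariety.prodLift (𝟙 B) (0 : B ⟶ C)) (AbelianVariety.fst B C) (AbelianVariety.prodLift_fst _ _)
      (fun y ↦ prodBlockDiagEquiv_apply_map_fst u v y) hP, exteriorPullbackEquiv_one_eq _ _⟩
  · refine mem_hodgeGroupOne_iff.2 ⟨_, exteriorPullbackEquiv_mem_hodgeGroup_of_retraction
      (AbelianVariety.prodLift (0 : C ⟶ B) (𝟙 C)) (AbelianVariety.snd B C) (AbelianVariety.prodLift_snd _ _)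
      (fun y ↦ prodBlockDiagEquiv_apply_map_snd u v y) hP, exteriorPullbackEquiv_one_eq _ _⟩

/-- **On `H¹`: `Hg(B × C)(ℂ)|_{H¹} ⊆ {u ⊕ v | u ∈ Hg(B)(ℂ)|_{H¹}, v ∈ Hg(C)(ℂ)|_{H¹}}`.** [cite: MoonenZarhin1999LowDim, §3 (3.1)]
[cite: Milne1999LefschetzClasses, §1 p. 643] -/
theorem exists_eq_prodBlockDiagEquiv_of_mem_hodgeGroupOne_prod {U : complexBetti (B.prod C).X 1 ≃ₗ[ℂ] complexBetti (B.prod C).X 1}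
    (hU : U ∈ hodgeGroupOne (B.prod C).dim (B.prod C).X) :
    ∃ u ∈ hodgeGroupOne B.dim B.X, ∃ v ∈ hodgeGroupOne C.dim C.X, U = prodBlockDiagEquiv u v := by
  obtain ⟨g', hg', rfl⟩ := mem_hodgeGroupOne_iff.1 hU
  obtain ⟨u, hu, v, hv, hg'eq⟩ := exists_eq_prodBlockDiagEquiv_of_mem_hodgeGroup_prod B C hg'
  refine ⟨u, hu, v, hv, ?_⟩
  have e := congrFun hg'eq 1
  rw [e]
  exact exteriorPullbackEquiv_one_eq _ _

end Product

/-! ### §3 Lemma 3.1 for the Hodge groups: the `Hg(B)(ℂ) × Hg(C)(ℂ)`-invariants of `H*(B × C)` are spanned by exterior products of Hodge classes -/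

section Invariants

variable {B C : AbelianVariety ℂ}

/-- **A cross product `pr_B^* e ∪ pr_C^* c` of Hodge-group invariants lies in the span of the exterior products of rational Hodge
classes.** For `e ∈ Hⁱ(B(ℂ); ℂ)` fixed by `Hg(B)(ℂ)` and `c ∈ Hʲ(C(ℂ); ℂ)` fixed by `Hg(C)(ℂ)`, `i + j = 2p`: if `i = 2l`, `j = 2k` then
`e` is a `ℂ`-combination of rational `(l,l)`-classes and `c` of rational `(k,k)`-classes (Deligne I Prop. 3.4 on the carriers,
`Deligne1982.mem_span_hodgeClasses_of_forall_hodgeGroup_apply_eq`), and the cross product is bilinear; if `i` is odd, `e = 0`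
(`Deligne1982.eq_zero_of_forall_hodgeGroup_apply_eq_of_odd`). [cite: Deligne1982HodgeCycles, I §3 Prop. 3.4]
[cite: MoonenZarhin1999LowDim, §3 (3.1)] -/
theorem cupProduct_map_fst_map_snd_mem_span_hodgeProductClasses {i j p : ℕ} (hij : i + j = 2 * p) {e : complexBetti B.X i}
    {c : complexBetti C.X j} (he : ∀ g ∈ hodgeGroup B.dim B.X, g i e = e) (hc : ∀ g ∈ hodgeGroup C.dim C.X, g j c = c) :
    cupProduct hij (complexBetti.map (AbelianVariety.fst B C).hom.hom.hom i e) (complexBetti.map (AbelianVariety.snd B C).hom.hom.hom j c) ∈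
      Submodule.span ℂ (hodgeProductClasses B C p) := by
  have hBsp : IsSmoothProjective B.dim B.X := AbelianVariety.isSmoothProjective_holds
  have hCsp : IsSmoothProjective C.dim C.X := AbelianVariety.isSmoothProjective_holds
  rcases Nat.even_or_odd i with ⟨l₀, hl₀⟩ | hodd
  · obtain ⟨l, rfl⟩ : ∃ l, i = 2 * l := ⟨l₀, by omega⟩
    obtain ⟨k, rfl⟩ : ∃ k, j = 2 * k := ⟨p - l, by omega⟩
    have he' := Deligne1982.mem_span_hodgeClasses_of_forall_hodgeGroup_apply_eq hBsp he
    have hc' := Deligne1982.mem_span_hodgeClasses_of_forall_hodgeGroup_apply_eq hCsp hc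
    clear he hc
    induction he' using Submodule.span_induction with
    | mem e₀ he₀ =>
      induction hc' using Submodule.span_induction with
      | mem c₀ hc₀ => exact Submodule.subset_span ⟨l, k, hij, e₀, c₀, he₀.1, he₀.2, hc₀.1, hc₀.2, rfl⟩
      | zero => rw [map_zero, map_zero]; exact Submodule.zero_mem _
      | add x y _ _ hx hy => rw [map_add, map_add]; exact Submodule.add_mem _ hx hy
      | smul t x _ hx => rw [map_smul, map_smul]; exact Submodule.smul_mem _ t hx
    | zero => rw [map_zero, map_zero, LinearMap.zero_apply]; exact Submodule.zero_mem _
    | add x y _ _ hx hy => rw [map_add, map_add, LinearMap.add_apply]; exact Submodule.add_mem _ hx hy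
    | smul t x _ hx => rw [map_smul, map_smul, LinearMap.smul_apply]; exact Submodule.smul_mem _ t hx
  · rw [Deligne1982.eq_zero_of_forall_hodgeGroup_apply_eq_of_odd hBsp hodd he, map_zero, map_zero, LinearMap.zero_apply]
    exact Submodule.zero_mem _

/-- **Milne's Lemma 3.1 for `G = Hg(B)`, `H = Hg(C)` with Deligne I Prop. 3.4: a class of `H²ᵖ((B × C)(ℂ); ℂ)` fixed by `⋀^{2p}(s ⊕ t)` for
all `s ∈ Hg(B)(ℂ)|_{H¹}`, `t ∈ Hg(C)(ℂ)|_{H¹}` lies in the `ℂ`-span of the exterior products `pr_B^* a ∪ pr_C^* b` of RATIONAL Hodge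
classes of the factors** (`hodgeProductClasses B C p`; no hypothesis on the class, nor on the pair `(B, C)`). Proof = Milne's ("Any
element `x` of `V ⊗ W` can be written uniquely `x = Σᵢ aᵢ ⊗ fᵢ` […] If `x` is fixed by all `(g, 1)` then `gaᵢ = aᵢ` […] and similarly
`(V^G ⊗ W)^{1 × H} = V^G ⊗ W^H`"): Künneth coordinates against bases of `H*(C)` (`kunnethSum_bijective`), `s ⊕ 1` acts on the
coefficients, `1 ⊕ t` through the matrices of `⋀ʲt` (`exists_eq_sum_repr_smul_of_forall_eq_sum_repr_smul`), and each term
`pr_B^* e ∪ pr_C^* c` of invariants is in the span (`cupProduct_map_fst_map_snd_mem_span_hodgeProductClasses`).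
[cite: Milne1999LefschetzClasses, Lemma 3.1 (pp. 652–653)] [cite: Deligne1982HodgeCycles, I §3 Prop. 3.4] [cite: MoonenZarhin1999LowDim, §3 (3.1)] -/
theorem mem_span_hodgeProductClasses_of_forall_exteriorPullback_prodBlockDiagEquiv_eq (p : ℕ) (x : complexBetti (B.prod C).X (2 * p))
    (hx : ∀ s ∈ hodgeGroupOne B.dim B.X, ∀ t ∈ hodgeGroupOne C.dim C.X,
      exteriorPullback (AbelianVariety.hasExteriorCohomologyH1_complexPoints (B.prod C)) (prodBlockDiagEquiv s t).toLinearMap (2 * p) x = x) :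
    x ∈ Submodule.span ℂ (hodgeProductClasses B C p) := by
  classical
  -- bases of the `Hʲ(C(ℂ); ℂ)`, `j ≤ 2 dim C`
  have hZ : IsSmoothProjective C.dim C.X := AbelianVariety.isSmoothProjective_holds (A := C)
  haveI := fun j ↦ finite_complexBetti hZ j
  let N : Fin (2 * C.dim + 1) → ℕ := fun j ↦ Module.finrank ℂ (complexBetti C.X j)
  let bC : (j : Fin (2 * C.dim + 1)) → Module.Basis (Fin (N j)) ℂ (complexBetti C.X j) :=
    fun j ↦ Module.finBasis ℂ (complexBetti C.X j)
  set hBB := AbelianVariety.hasExteriorCohomologyH1_complexPoints B with hBB_def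
  set hCC := AbelianVariety.hasExteriorCohomologyH1_complexPoints C with hCC_def
  -- the Künneth sum and the coordinates of `x`
  let Ψ : ((j : {j : Fin (2 * C.dim + 1) // (j : ℕ) ≤ 2 * p}) → Fin (N j.1) →
      complexBetti B.X (2 * p - (j.1 : ℕ))) → complexBetti (B.prod C).X (2 * p) := fun a ↦
    ∑ j : {j : Fin (2 * C.dim + 1) // (j : ℕ) ≤ 2 * p}, ∑ i : Fin (N j.1),
      cupProduct (Nat.sub_add_cancel j.2)
        (complexBetti.map (AbelianVariety.fst B C).hom.hom.hom (2 * p - (j.1 : ℕ)) (a j i))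
        (complexBetti.map (AbelianVariety.snd B C).hom.hom.hom (j.1 : ℕ) (bC j.1 i))
  have hΨ : Function.Bijective Ψ := kunnethSum_bijective bC (2 * p)
  obtain ⟨a, ha⟩ := hΨ.2 x
  -- (i) the coefficients are `Hg(B)`-invariant (`s ⊕ 1`)
  have hinvB : ∀ j i, ∀ s ∈ hodgeGroupOne B.dim B.X,
      exteriorPullback hBB s.toLinearMap (2 * p - (j.1 : ℕ)) (a j i) = a j i := by
    intro j i s hs
    have h1 := hx s hs 1 (one_mem _)
    rw [← ha] at h1
    have h2 := (exteriorPullback_prodBlockDiagEquiv_one_kunnethSum (b := bC) (k := 2 * p) s a).symm.trans h1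
    exact congrFun (congrFun (hΨ.1 h2) j) i
  -- (ii) `1 ⊕ t` acts on the coefficients through the matrix of `⋀ʲt`
  have hmat : ∀ t ∈ hodgeGroupOne C.dim C.X, ∀ j i',
      a j i' = ∑ i, (bC j.1).repr (exteriorPullback hCC t.toLinearMap (j.1 : ℕ) (bC j.1 i)) i' • a j i := by
    intro t ht j i'
    have h1 := hx 1 (one_mem _) t ht
    rw [← ha] at h1
    have h2 := (exteriorPullback_one_prodBlockDiagEquiv_kunnethSum (b := bC) (k := 2 * p) t a).symm.trans h1
    exact (congrFun (congrFun (hΨ.1 h2) j) i').symm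
  -- (iii) Lemma 3.1, degree by degree: `Σ_i a_{j,i} ⊗ b_{j,i} = Σ_r e_{j,r} ⊗ c_{j,r}` with invariant `e`, `c`
  have hT : ∀ j : {j : Fin (2 * C.dim + 1) // (j : ℕ) ≤ 2 * p},
      ∃ (R : ℕ) (e : Fin R → complexBetti B.X (2 * p - (j.1 : ℕ))) (c : Fin R → complexBetti C.X (j.1 : ℕ)),
        (∀ r, ∀ s ∈ hodgeGroupOne B.dim B.X,
            exteriorPullback hBB (s : complexBetti B.X 1 →ₗ[ℂ] complexBetti B.X 1) (2 * p - (j.1 : ℕ)) (e r) = e r) ∧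
          (∀ r, ∀ t ∈ hodgeGroupOne C.dim C.X,
            exteriorPullback hCC (t : complexBetti C.X 1 →ₗ[ℂ] complexBetti C.X 1) (j.1 : ℕ) (c r) = c r) ∧
          ∀ i, a j i = ∑ r, (bC j.1).repr (c r) i • e r := by
    intro j
    obtain ⟨R, e, c, he, hc, hae⟩ := exists_eq_sum_repr_smul_of_forall_eq_sum_repr_smul (bC j.1) (a j)
      {T | ∃ t ∈ hodgeGroupOne C.dim C.X, T = exteriorPullback hCC t.toLinearMap (j.1 : ℕ)}
      (by rintro T ⟨t, ht, rfl⟩ i'; exact hmat t ht j i')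
    exact ⟨R, e, c,
      fun r s hs ↦ apply_eq_self_of_mem_span_of_forall_apply_eq_self _ (a j) (fun i ↦ hinvB j i s hs) (he r),
      fun r t ht ↦ hc _ ⟨t, ht, rfl⟩ r, hae⟩
  choose R e c he hc hae using hT
  -- (iv) regroup: `x = Σ_j Σ_r pr_B^* e_{j,r} ∪ pr_C^* c_{j,r}`
  have hx' : x = ∑ j : {j : Fin (2 * C.dim + 1) // (j : ℕ) ≤ 2 * p}, ∑ r : Fin (R j),
      cupProduct (Nat.sub_add_cancel j.2)
        (complexBetti.map (AbelianVariety.fst B C).hom.hom.hom (2 * p - (j.1 : ℕ)) (e j r))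
        (complexBetti.map (AbelianVariety.snd B C).hom.hom.hom (j.1 : ℕ) (c j r)) := by
    rw [← ha]
    refine Finset.sum_congr rfl fun j _ ↦ ?_
    -- abbreviate the cross products `X v w = pr_B^* v ∪ pr_C^* w`
    set X : complexBetti B.X (2 * p - (j.1 : ℕ)) → complexBetti C.X (j.1 : ℕ) → complexBetti (B.prod C).X (2 * p) :=
      fun v w ↦ cupProduct (Nat.sub_add_cancel j.2)
        (complexBetti.map (AbelianVariety.fst B C).hom.hom.hom (2 * p - (j.1 : ℕ)) v)
        (complexBetti.map (AbelianVariety.snd B C).hom.hom.hom (j.1 : ℕ) w) with hXdef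
    have hX1 : ∀ (ι' : Type) (S : Finset ι') (f : ι' → ℂ) (v : ι' → complexBetti B.X (2 * p - (j.1 : ℕ))) w,
        X (∑ l ∈ S, f l • v l) w = ∑ l ∈ S, f l • X (v l) w := by
      intro ι' S f v w
      rw [hXdef]
      dsimp only
      rw [map_sum, map_sum, LinearMap.sum_apply]
      refine Finset.sum_congr rfl fun l _ ↦ ?_
      rw [map_smul, map_smul, LinearMap.smul_apply]
    have hX2 : ∀ (ι' : Type) (S : Finset ι') (f : ι' → ℂ) (v) (w : ι' → complexBetti C.X (j.1 : ℕ)),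
        X v (∑ l ∈ S, f l • w l) = ∑ l ∈ S, f l • X v (w l) := by
      intro ι' S f v w
      rw [hXdef]
      dsimp only
      rw [map_sum, map_sum]
      refine Finset.sum_congr rfl fun l _ ↦ ?_
      rw [map_smul, map_smul]
    calc ∑ i : Fin (N j.1), X (a j i) (bC j.1 i)
        = ∑ i : Fin (N j.1), ∑ r : Fin (R j), (bC j.1).repr (c j r) i • X (e j r) (bC j.1 i) := by
          refine Finset.sum_congr rfl fun i _ ↦ ?_
          rw [hae j i, hX1]
      _ = ∑ r : Fin (R j), ∑ i : Fin (N j.1), (bC j.1).repr (c j r) i • X (e j r) (bC j.1 i) := Finset.sum_comm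
      _ = ∑ r : Fin (R j), X (e j r) (c j r) := by
          refine Finset.sum_congr rfl fun r _ ↦ ?_
          rw [← hX2]
          congr 1
          exact (bC j.1).sum_repr (c j r)
  rw [hx']
  refine Submodule.sum_mem _ fun j _ ↦ Submodule.sum_mem _ fun r _ ↦ ?_
  exact cupProduct_map_fst_map_snd_mem_span_hodgeProductClasses (Nat.sub_add_cancel j.2)
    (forall_hodgeGroup_apply_eq_of_forall_exteriorPullback_eq (he j r))
    (forall_hodgeGroup_apply_eq_of_forall_exteriorPullback_eq (hc j r))

/-- Conversely (definitional half): `⋀•(s ⊕ t)` fixes the span of the exterior products of rational Hodge classes for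
`s ∈ Hg(B)(ℂ)|_{H¹}`, `t ∈ Hg(C)(ℂ)|_{H¹}` (`⋀•(s ⊕ t)(pr_B^* a ∪ pr_C^* b) = pr_B^*(⋀•s a) ∪ pr_C^*(⋀•t b)`, and `⋀•s`, `⋀•t` fix the
rational Hodge classes of the factors). [cite: MoonenZarhin1999LowDim, §3 (3.1)] [cite: Milne1999LefschetzClasses, Lemma 3.1] -/
theorem exteriorPullback_prodBlockDiagEquiv_eq_self_of_mem_span_hodgeProductClasses
    {s : complexBetti B.X 1 ≃ₗ[ℂ] complexBetti B.X 1} (hs : s ∈ hodgeGroupOne B.dim B.X)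
    {t : complexBetti C.X 1 ≃ₗ[ℂ] complexBetti C.X 1} (ht : t ∈ hodgeGroupOne C.dim C.X) {p : ℕ}
    {x : complexBetti (B.prod C).X (2 * p)} (hx : x ∈ Submodule.span ℂ (hodgeProductClasses B C p)) :
    exteriorPullback (AbelianVariety.hasExteriorCohomologyH1_complexPoints (B.prod C)) (prodBlockDiagEquiv s t).toLinearMap (2 * p) x = x := by
  induction hx using Submodule.span_induction with
  | mem y hy =>
    obtain ⟨l, k, hlk, a, b, ha, ha', hb, hb', rfl⟩ := hy
    have e := exteriorPullback_prodBlockDiagEquiv_cross (s := s) (t := t) hlk a b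
    rw [exteriorPullback_apply_eq_self_of_mem_hodgeGroupOne hs ha ha', exteriorPullback_apply_eq_self_of_mem_hodgeGroupOne ht hb hb'] at e
    exact e
  | zero => exact map_zero _
  | add y z _ _ hy hz => rw [map_add, hy, hz]; rfl
  | smul r y _ hy => rw [map_smul, hy]; rfl

/-- **`(H²ᵖ((B × C)(ℂ); ℂ))^{Hg(B)(ℂ) × Hg(C)(ℂ)} = span_ℂ (exterior products of rational Hodge classes)`** (Lemma 3.1 + Deligne I 3.4,
both inclusions). [cite: Milne1999LefschetzClasses, Lemma 3.1 (pp. 652–653)] [cite: Deligne1982HodgeCycles, I §3 Prop. 3.4] -/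
theorem forall_exteriorPullback_prodBlockDiagEquiv_eq_iff_mem_span_hodgeProductClasses (p : ℕ) (x : complexBetti (B.prod C).X (2 * p)) :
    (∀ s ∈ hodgeGroupOne B.dim B.X, ∀ t ∈ hodgeGroupOne C.dim C.X,
      exteriorPullback (AbelianVariety.hasExteriorCohomologyH1_complexPoints (B.prod C)) (prodBlockDiagEquiv s t).toLinearMap (2 * p) x = x) ↔
      x ∈ Submodule.span ℂ (hodgeProductClasses B C p) :=
  ⟨mem_span_hodgeProductClasses_of_forall_exteriorPullback_prodBlockDiagEquiv_eq p x,
    fun hx _ hs _ ht ↦ exteriorPullback_prodBlockDiagEquiv_eq_self_of_mem_span_hodgeProductClasses hs ht hx⟩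

end Invariants

/-! ### §4 Moonen–Zarhin (3.1), `⟹`: if `Hg(B × C) = Hg(B) × Hg(C)` then the Hodge classes of every `B^{a+1} × C^{a+1}` are spanned by the exterior products -/

section Split

variable (B C : AbelianVariety ℂ)

/-- **If the Hodge group of `B × C` splits, the Hodge classes of `B × C` are spanned by the exterior products of Hodge classes of
the factors** (`HodgeClassesProductSpan B C` of `HodgeTheory/HodgeGroupProductCMFactor`). "Splits", Tannaka-free: for all
`u ∈ Hg(B)(ℂ)|_{H¹}`, `v ∈ Hg(C)(ℂ)|_{H¹}` the family `⋀•(u ⊕ v)` lies in `Hg(B × C)(ℂ)` (with §2: `Hg(B × C) = Hg(B) × Hg(C)` as sets of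
block-diagonal pairs). Moonen–Zarhin: "We may have that `Hg(X_1 × X_2) ≠ Hg(X_1) × Hg(X_2)`. This holds if and only if for some `m`
and `n` the Hodge ring `B(X_1^m × X_2^n)` is not generated by the elements coming from `B(X_1^m)` and `B(X_2^n)`" — here the case
`m = n = 1` of the contrapositive: a rational `(p,p)`-class of `B × C` is fixed by `Hg(B × C)(ℂ) ∋ ⋀•(u ⊕ v)`, so §3 applies.
[cite: MoonenZarhin1999LowDim, §3 (3.1)] [cite: Milne1999LefschetzClasses, Lemma 3.1] -/
theorem hodgeClassesProductSpan_of_forall_prodBlockDiagEquiv_mem_hodgeGroup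
    (hsplit : ∀ u ∈ hodgeGroupOne B.dim B.X, ∀ v ∈ hodgeGroupOne C.dim C.X,
      (fun k ↦ exteriorPullbackEquiv (AbelianVariety.hasExteriorCohomologyH1_complexPoints (B.prod C)) (prodBlockDiagEquiv u v) k) ∈
        hodgeGroup (B.prod C).dim (B.prod C).X) :
    HodgeClassesProductSpan B C := by
  intro p c hc hc'
  have hc'' : IsOfHodgeType (B.prod C).dim (B.prod C).X (2 * p) p p c := by
    rw [AbelianVariety.dim_prod]; exact hc'
  exact mem_span_hodgeProductClasses_of_forall_exteriorPullback_prodBlockDiagEquiv_eq p c fun u hu v hv ↦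
    apply_eq_self_of_mem_hodgeGroup (hsplit u hu v hv) hc hc''

/-- **Splitting is inherited by equal powers**: if `⋀•(u ⊕ v) ∈ Hg(B × C)(ℂ)` for all `u ∈ Hg(B)(ℂ)|_{H¹}`, `v ∈ Hg(C)(ℂ)|_{H¹}`, then the
same holds for the pair `(B^{a+1}, C^{a+1})`: `Hg(B^{a+1})|_{H¹} = {u^{⊕(a+1)}}` (Moonen–Zarhin §1, `mem_hodgeGroupOne_powSucc_iff`),
`⋀•((u ⊕ v)^{⊕(a+1)}) ∈ Hg((B × C)^{a+1})` (idem), and the shuffle `(B × C)^{a+1} ≅ B^{a+1} × C^{a+1}` transfers it to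
`⋀•(u^{⊕(a+1)} ⊕ v^{⊕(a+1)})` (§0–§1). [cite: MoonenZarhin1999LowDim, §1 and §3 (3.1)] -/
theorem forall_prodBlockDiagEquiv_mem_hodgeGroup_powSucc
    (hsplit : ∀ u ∈ hodgeGroupOne B.dim B.X, ∀ v ∈ hodgeGroupOne C.dim C.X,
      (fun k ↦ exteriorPullbackEquiv (AbelianVariety.hasExteriorCohomologyH1_complexPoints (B.prod C)) (prodBlockDiagEquiv u v) k) ∈
        hodgeGroup (B.prod C).dim (B.prod C).X) (a : ℕ) :
    ∀ u' ∈ hodgeGroupOne (B.powSucc a).dim (B.powSucc a).X, ∀ v' ∈ hodgeGroupOne (C.powSucc a).dim (C.powSucc a).X,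
      (fun k ↦ exteriorPullbackEquiv (AbelianVariety.hasExteriorCohomologyH1_complexPoints ((B.powSucc a).prod (C.powSucc a)))
        (prodBlockDiagEquiv u' v') k) ∈ hodgeGroup ((B.powSucc a).prod (C.powSucc a)).dim ((B.powSucc a).prod (C.powSucc a)).X := by
  intro u' hu' v' hv'
  obtain ⟨u, hu, rfl⟩ := (mem_hodgeGroupOne_powSucc_iff B a u').1 hu'
  obtain ⟨v, hv, rfl⟩ := (mem_hodgeGroupOne_powSucc_iff C a v').1 hv'
  obtain ⟨σ, τ, -, hτσ, hint⟩ := exists_shuffle_powSucc_prod B C a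
  have h1 : prodBlockDiagEquiv u v ∈ hodgeGroupOne (B.prod C).dim (B.prod C).X :=
    mem_hodgeGroupOne_iff.2 ⟨_, hsplit u hu v hv, exteriorPullbackEquiv_one_eq _ _⟩
  exact exteriorPullbackEquiv_mem_hodgeGroup_of_retraction τ σ hτσ (hint u v) (diagPowExterior_mem_hodgeGroup_powSucc (B.prod C) a h1)

/-- **Moonen–Zarhin (3.1), `⟹` on all (equal) powers**: if the Hodge group of `B × C` splits, then for every `a` the rational
`(p,p)`-classes of `B^{a+1} × C^{a+1}` are spanned by the exterior products of rational Hodge classes of `B^{a+1}` and `C^{a+1}`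
(`HodgeClassesProductSpan (B^{a+1}) (C^{a+1})`). [cite: MoonenZarhin1999LowDim, §3 (3.1)] -/
theorem hodgeClassesProductSpan_powSucc_of_forall_prodBlockDiagEquiv_mem_hodgeGroup
    (hsplit : ∀ u ∈ hodgeGroupOne B.dim B.X, ∀ v ∈ hodgeGroupOne C.dim C.X,
      (fun k ↦ exteriorPullbackEquiv (AbelianVariety.hasExteriorCohomologyH1_complexPoints (B.prod C)) (prodBlockDiagEquiv u v) k) ∈
        hodgeGroup (B.prod C).dim (B.prod C).X) (a : ℕ) :
    HodgeClassesProductSpan (B.powSucc a) (C.powSucc a) :=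
  hodgeClassesProductSpan_of_forall_prodBlockDiagEquiv_mem_hodgeGroup _ _ (forall_prodBlockDiagEquiv_mem_hodgeGroup_powSucc B C hsplit a)

/-! ### §5 Moonen–Zarhin (3.1), `⟸`: if the Hodge classes of every `B^{a+1} × C^{a+1}` are spanned by the exterior products, the Hodge group splits -/

/-- **Moonen–Zarhin (3.1), `⟸`, Tannaka-free.** If for every `a` the rational `(p,p)`-classes of `B^{a+1} × C^{a+1}` are spanned by
the exterior products of rational Hodge classes of the factors, then `⋀•(u ⊕ v) ∈ Hg(B × C)(ℂ)` for all `u ∈ Hg(B)(ℂ)|_{H¹}`,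
`v ∈ Hg(C)(ℂ)|_{H¹}`: the Künneth family `⋀•((u ⊕ v)^{⊕(a+1)})` of `⋀•(u ⊕ v)` fixes every Hodge class `c` of `(B × C)^{a+1}` — transport
`c` along the shuffle `σ : (B × C)^{a+1} ≅ B^{a+1} × C^{a+1}` (§0), where it is a combination of exterior products
`pr^* x ∪ pr^* y` of Hodge classes of `B^{a+1}`, `C^{a+1}`, fixed by `⋀•(u^{⊕(a+1)} ⊕ v^{⊕(a+1)})` because `⋀•(u^{⊕(a+1)})`,
`⋀•(v^{⊕(a+1)})` lie in `Hg(B^{a+1})`, `Hg(C^{a+1})` (Moonen–Zarhin §1, `diagPowExterior_mem_hodgeGroup_powSucc`) — and `σ^*`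
intertwines. [cite: MoonenZarhin1999LowDim, §1 and §3 (3.1)] [cite: Milne1999LefschetzClasses, §1 p. 643 and Lemma 3.1] -/
theorem prodBlockDiagEquiv_mem_hodgeGroup_of_forall_hodgeClassesProductSpan_powSucc
    (hspan : ∀ a : ℕ, HodgeClassesProductSpan (B.powSucc a) (C.powSucc a))
    {u : complexBetti B.X 1 ≃ₗ[ℂ] complexBetti B.X 1} (hu : u ∈ hodgeGroupOne B.dim B.X)
    {v : complexBetti C.X 1 ≃ₗ[ℂ] complexBetti C.X 1} (hv : v ∈ hodgeGroupOne C.dim C.X) :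
    (fun k ↦ exteriorPullbackEquiv (AbelianVariety.hasExteriorCohomologyH1_complexPoints (B.prod C)) (prodBlockDiagEquiv u v) k) ∈
      hodgeGroup (B.prod C).dim (B.prod C).X := by
  refine exteriorPullbackEquiv_mem_hodgeGroup_of_forall fun a p c hc hc' ↦ ?_
  obtain ⟨σ, τ, hστ, -, hint⟩ := exists_shuffle_powSucc_prod B C a
  have hQ : IsSmoothProjective ((B.powSucc a).prod (C.powSucc a)).dim ((B.powSucc a).prod (C.powSucc a)).X :=
    AbelianVariety.isSmoothProjective_holds
  have hPP : IsSmoothProjective ((B.prod C).powSucc a).dim ((B.prod C).powSucc a).X := AbelianVariety.isSmoothProjective_holds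
  -- `c' = τ^* c` is a rational `(p,p)`-class of `B^{a+1} × C^{a+1}`, hence in the span of the exterior products
  have hmem : complexBetti.map τ.hom.hom.hom (2 * p) c ∈ Submodule.span ℂ (hodgeProductClasses (B.powSucc a) (C.powSucc a) p) := by
    refine hspan a p _ (hc.pullback _) ?_
    rw [← AbelianVariety.dim_prod]
    exact hc'.map_of_isSmoothProjective hQ hPP τ.hom.hom.hom
  -- `⋀•(u^{⊕(a+1)} ⊕ v^{⊕(a+1)})` fixes it
  have hu' : diagPow B u a ∈ hodgeGroupOne (B.powSucc a).dim (B.powSucc a).X := (mem_hodgeGroupOne_powSucc_iff B a _).2 ⟨u, hu, rfl⟩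
  have hv' : diagPow C v a ∈ hodgeGroupOne (C.powSucc a).dim (C.powSucc a).X := (mem_hodgeGroupOne_powSucc_iff C a _).2 ⟨v, hv, rfl⟩
  have hfix := exteriorPullback_prodBlockDiagEquiv_eq_self_of_mem_span_hodgeProductClasses hu' hv' hmem
  -- transport back along `σ` (`σ ≫ τ = 𝟙`, `σ^*` intertwines)
  rw [← map_map_of_comp_eq_id hστ (2 * p) c, diagPowExterior, exteriorPullbackEquiv_apply,
    exteriorPullback_map_of_intertwine σ (diagPow (B.prod C) (prodBlockDiagEquiv u v) a).toLinearMap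
      (prodBlockDiagEquiv (diagPow B u a) (diagPow C v a)).toLinearMap (fun y ↦ hint u v y), hfix]

/-! ### §6 The criterion, assembled -/

/-- **MOONEN–ZARHIN 1999 (3.1), TANNAKA-FREE: `Hg(B × C) = Hg(B) × Hg(C)` iff for every `a` the Hodge classes of `B^{a+1} × C^{a+1}` are
spanned by the exterior products of Hodge classes of `B^{a+1}` and of `C^{a+1}`.** "Splits" = every block-diagonal pair of
elements of `Hg(B)(ℂ)|_{H¹}`, `Hg(C)(ℂ)|_{H¹}` extends (through `⋀•`) to an element of `Hg(B × C)(ℂ)` (the converse containment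
`Hg(B × C) ≤ Hg(B) × Hg(C)` holds always, §2). The printed criterion quantifies over all `X_1^m × X_2^n`; since
`Hg(X_1^{n_1} × X_2^{n_2}) = Hg(X_1 × X_2)` (Moonen–Zarhin §1) the equal exponents suffice, and only they are recorded here.
[cite: MoonenZarhin1999LowDim, §1 and §3 (3.1)] -/
theorem forall_prodBlockDiagEquiv_mem_hodgeGroup_iff_forall_hodgeClassesProductSpan_powSucc :
    (∀ u ∈ hodgeGroupOne B.dim B.X, ∀ v ∈ hodgeGroupOne C.dim C.X,
      (fun k ↦ exteriorPullbackEquiv (AbelianVariety.hasExteriorCohomologyH1_complexPoints (B.prod C)) (prodBlockDiagEquiv u v) k) ∈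
        hodgeGroup (B.prod C).dim (B.prod C).X) ↔
      ∀ a : ℕ, HodgeClassesProductSpan (B.powSucc a) (C.powSucc a) :=
  ⟨fun h a ↦ hodgeClassesProductSpan_powSucc_of_forall_prodBlockDiagEquiv_mem_hodgeGroup B C h a,
    fun h _ hu _ hv ↦ prodBlockDiagEquiv_mem_hodgeGroup_of_forall_hodgeClassesProductSpan_powSucc B C h hu hv⟩

/-- **Under splitting, `Hg(B × C)(ℂ) = {⋀•(u ⊕ v) | u ∈ Hg(B)(ℂ)|_{H¹}, v ∈ Hg(C)(ℂ)|_{H¹}}` exactly** (§2 with the hypothesis).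
[cite: MoonenZarhin1999LowDim, §3 (3.1)] -/
theorem mem_hodgeGroup_prod_iff_of_forall_prodBlockDiagEquiv_mem
    (hsplit : ∀ u ∈ hodgeGroupOne B.dim B.X, ∀ v ∈ hodgeGroupOne C.dim C.X,
      (fun k ↦ exteriorPullbackEquiv (AbelianVariety.hasExteriorCohomologyH1_complexPoints (B.prod C)) (prodBlockDiagEquiv u v) k) ∈
        hodgeGroup (B.prod C).dim (B.prod C).X)
    (g' : ∀ k : ℕ, complexBetti (B.prod C).X k ≃ₗ[ℂ] complexBetti (B.prod C).X k) :
    g' ∈ hodgeGroup (B.prod C).dim (B.prod C).X ↔ ∃ u ∈ hodgeGroupOne B.dim B.X, ∃ v ∈ hodgeGroupOne C.dim C.X,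
      g' = fun k ↦ exteriorPullbackEquiv (AbelianVariety.hasExteriorCohomologyH1_complexPoints (B.prod C)) (prodBlockDiagEquiv u v) k :=
  ⟨exists_eq_prodBlockDiagEquiv_of_mem_hodgeGroup_prod B C, fun ⟨u, hu, v, hv, e⟩ ↦ e ▸ hsplit u hu v hv⟩

/-- **On `H¹`, under splitting: `Hg(B × C)(ℂ)|_{H¹} = {u ⊕ v | u ∈ Hg(B)(ℂ)|_{H¹}, v ∈ Hg(C)(ℂ)|_{H¹}}`.** [cite: MoonenZarhin1999LowDim, §3 (3.1)] -/
theorem mem_hodgeGroupOne_prod_iff_of_forall_prodBlockDiagEquiv_mem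
    (hsplit : ∀ u ∈ hodgeGroupOne B.dim B.X, ∀ v ∈ hodgeGroupOne C.dim C.X,
      (fun k ↦ exteriorPullbackEquiv (AbelianVariety.hasExteriorCohomologyH1_complexPoints (B.prod C)) (prodBlockDiagEquiv u v) k) ∈
        hodgeGroup (B.prod C).dim (B.prod C).X)
    (U : complexBetti (B.prod C).X 1 ≃ₗ[ℂ] complexBetti (B.prod C).X 1) :
    U ∈ hodgeGroupOne (B.prod C).dim (B.prod C).X ↔ ∃ u ∈ hodgeGroupOne B.dim B.X, ∃ v ∈ hodgeGroupOne C.dim C.X, U = prodBlockDiagEquiv u v := by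
  refine ⟨exists_eq_prodBlockDiagEquiv_of_mem_hodgeGroupOne_prod B C, ?_⟩
  rintro ⟨u, hu, v, hv, rfl⟩
  exact mem_hodgeGroupOne_iff.2 ⟨_, hsplit u hu v hv, exteriorPullbackEquiv_one_eq _ _⟩

/-- **HC is multiplicative under splitting**: if `Hg(B × C)` splits and the Hodge conjecture holds for `B^{a+1}` and `C^{a+1}`, it holds
for `B^{a+1} × C^{a+1}` (exterior products of algebraic classes are algebraic: the tree's `hodgeConjectureFor_prod_of_productSpan`).
Nothing here is a case of the Hodge conjecture beyond this implication. [cite: MoonenZarhin1999LowDim, §3 (3.1)]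
[cite: VoisinHodgeII2003, proof of Prop. 9.20 (first display)] -/
theorem hodgeConjectureFor_powSucc_prod_powSucc_of_forall_prodBlockDiagEquiv_mem
    (hsplit : ∀ u ∈ hodgeGroupOne B.dim B.X, ∀ v ∈ hodgeGroupOne C.dim C.X,
      (fun k ↦ exteriorPullbackEquiv (AbelianVariety.hasExteriorCohomologyH1_complexPoints (B.prod C)) (prodBlockDiagEquiv u v) k) ∈
        hodgeGroup (B.prod C).dim (B.prod C).X) (a : ℕ)
    (hB : HodgeConjectureFor (B.powSucc a).dim (B.powSucc a).X) (hC : HodgeConjectureFor (C.powSucc a).dim (C.powSucc a).X) :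
    HodgeConjectureFor ((B.powSucc a).prod (C.powSucc a)).dim ((B.powSucc a).prod (C.powSucc a)).X :=
  hodgeConjectureFor_prod_of_productSpan _ _ (hodgeClassesProductSpan_powSucc_of_forall_prodBlockDiagEquiv_mem_hodgeGroup B C hsplit a) hB hC

end Split

end Literature.AlgebraicGeometry.Milne1999

end
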